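import Mathlib.Analysis.Asymptotics.AsymptoticEquivalent
import Mathlib.NumberTheory.ArithmeticFunction.Liouville
import Mathlib.NumberTheory.ArithmeticFunction.VonMangoldt
import Mathlib.NumberTheory.PrimeCounting
import Literature.NumberTheory.Sieve.LevelOfDistribution
import Literature.NumberTheory.Sieve.SieveFramework
import Literature.NumberTheory.Sieve.ParityWave0
import HarnessLib

-- provenance: harness21/H21/H21/Statements/Parity/ParityBarrier.lean @ bd548d0 (interim HEAD d8f2665); M5 mechanical rewrite
/-!
# Sieve axioms and the parity barrier

Family `parity` (trunks T-ANT / T-SIEVE; outline `AntSieve.md`, §3, item `ParityBarrier`).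
Target statements **parity.S26** (level of distribution / sieve dimension of the shifted primes,
packaged as genuine theorems) and **parity.S32** (the parity barrier: Selberg's examples and
Bombieri's asymptotic sieve).

Contents:

* `rfl` bridges between the accepted Wave0 glue (`Literature.NumberTheory.Sieve.ParityWave0.chebyshevPsiMod`,
  `Literature.NumberTheory.Sieve.ParityWave0.primeCountingMod`) and the prelude copies, the derivation of
  `Literature.NumberTheory.Sieve.BombieriVinogradovStatement` from Wave0's parity.S27 `Literature.NumberTheory.Sieve.bombieri_vinogradov`, and
  the equivalence of the prelude's `Literature.NumberTheory.Sieve.LevelOfDistribution.ElliottHalberstam` with Wave0's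
  `Literature.NumberTheory.Sieve.ElliottHalberstamConjecture` (parity.S25);
* **parity.S26**: Bombieri–Vinogradov on the sequence layer,
  `∀ θ < 1/2, HasLevelOfDistribution (SieveSequence.shiftedPrimes 2) θ`, and the dimension-`1`
  property of the shifted primes (the prelude notions `HasLevelOfDistribution` (Type I),
  `HasTypeIIRange` (Type II, Ford–Maynard), `HasSieveDimension` (dimension `κ`),
  `IsWellFactorable` (BFI) are the content of the definition-role id parity.S26);
* **parity.S32** (i): Selberg's sequences `a_n = 1 ± λ(n)` (`selbergParitySeq`), which satisfy every
  one-sequence Type-I axiom (size `x`, density `1/d`, dimension `1`, level `x^θ` for every `θ < 1`)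
  yet carry zero, resp. double, prime mass; the resulting impossibility of a Type-I lower bound for
  primes (`parity_barrier_typeI`, `no_typeI_prime_lower_bound`);
* **parity.S32** (ii): the generalised von Mangoldt functions `Λ_k = μ ⋆ log^k`
  (`generalizedVonMangoldt`), Bombieri's asymptotic sieve `∑_{n ≤ x} Λ_k(n) a_n ∼ k H x (log x)^{k−1}`
  for `k ≥ 2` (`bombieri_asymptotic_sieve`), its application to `Λ(n+2)` under Elliott–Halberstam,
  and the indeterminacy for `k = 1`: the prime mass is determined by the Type-I data only up to a
  factor `δ ∈ [0, 2]`, every value of which occurs (`bombieri_asymptotic_sieve_indeterminacy`,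
  `prime_mass_le_two`).

Mathlib (pinned commit) has `ArithmeticFunction.liouville` (`λ`, with `isMultiplicative_liouville`),
`ArithmeticFunction.log`, `ArithmeticFunction.ppow`, the coercion `μ : ArithmeticFunction ℝ` with
`moebius_mul_log_eq_vonMangoldt : μ * log = Λ`, `Nat.primesLE`, `Nat.primeCounting`
(`primesLE_card_eq_primeCounting`), and `ArithmeticFunction.pdiv` (our `reciprocalDensity` is
`ζ.pdiv id` written directly). It has no `Λ_k`, no Selberg parity examples and no asymptotic sieve;
these are added here.

## References

* A. Selberg, *On elementary methods in prime number theory and their limitations*, 11. Skand.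
  Mat. Kongr. Trondheim (1949), 13–22; *Sieve methods*, Proc. Sympos. Pure Math. 20 (1971), 311–351
  (Collected Papers I/II).
* E. Bombieri, *On the large sieve*, Mathematika 12 (1965); *The asymptotic sieve*, Rend. Accad. Naz.
  XL (5) 1/2 (1975/76), 243–269.
* J. Friedlander, H. Iwaniec, *Opera de Cribro* (2010), Ch. 3 (Bombieri's sieve) and §16.
* K. Ford, J. Maynard, *On the theory of prime producing sieves*, arXiv:2407.14368 (2024), §1.
* In-repo: `summits/gb/merged/sharpen-chen/lean/GbParityInterface.lean` (`GbParity.ClassABarrier`).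

## Design notes

* Statement files use `namespace Literature` (outline §0), so the prelude names `chebyshevPsiMod`,
  `ElliottHalberstam`, … are never ambiguous with the Wave0 glue in `Literature.Parity`.
* `selbergParitySeq (sgn : ℤˣ)`: `a_n = 1 + sgn · λ(n)` (an integer, cast to `ℝ`), `X(x) = x`,
  `g(d) = 1/d`. For `sgn = 1` the sequence vanishes on primes; for `sgn = −1` it is `2` on primes.
* Bombieri's asymptotic sieve is transcribed in the shape of Friedlander–Iwaniec Ch. 3 with `X = x`
  (as the outline prescribes) and with the dimension-`1` regularity of `g` made explicit through
  `SieveSequence.HasDensityConstant` (the constant `H = ∏_p (1 − g(p))(1 − 1/p)⁻¹` as an ordered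
  limit, OUTLINE D-SIEVE-1) and a Mertens-type asymptotic for `∑_{p ≤ x} g(p) log p`; a crude
  second-moment bound on `a_n` is also assumed. These hypotheses are (harmless) strengthenings of
  Bombieri's, recorded as such; the conclusion is Bombieri's.
-/

open Filter Asymptotics Finset
open scoped ArithmeticFunction.Moebius ArithmeticFunction.vonMangoldt
  ArithmeticFunction.omega Topology

noncomputable section

namespace Literature.NumberTheory.Sieve

/-! ### Bridges to the accepted Wave0 glue -/

/-- Bridge (outline §0): the Wave0 glue `Literature.NumberTheory.Sieve.ParityWave0.chebyshevPsiMod` and the prelude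
`Literature.NumberTheory.Sieve.LevelOfDistribution.chebyshevPsiMod` (`ψ(x; q, a)`, Iwaniec–Kowalski §5.6) have byte-identical bodies. [folklore] -/
theorem chebyshevPsiMod_eq_wave0 : Literature.NumberTheory.Sieve.ParityWave0.chebyshevPsiMod = LevelOfDistribution.chebyshevPsiMod := rfl

/-- Bridge (outline §0): the Wave0 glue `Literature.NumberTheory.Sieve.ParityWave0.primeCountingMod` and the prelude
`Literature.NumberTheory.Sieve.LevelOfDistribution.primeCountingMod` (`π(x; q, a)`) have byte-identical bodies. [folklore] -/
theorem primeCountingMod_eq_wave0 : Literature.NumberTheory.Sieve.ParityWave0.primeCountingMod = LevelOfDistribution.primeCountingMod := rfl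

/-- The **Bombieri–Vinogradov theorem** in level-of-distribution form: the primes have level `x^θ`
for every `θ < 1/2` (Bombieri, Mathematika 12 (1965); A. I. Vinogradov 1965; Iwaniec–Kowalski
Thm 17.1). A corollary of the accepted Wave0 statement parity.S27
`Literature.NumberTheory.Sieve.bombieri_vinogradov`: for `θ < 1/2` and `ε > 0` one has
`x^{θ−ε} ≤ x^{1/2} (log x)^{−B}` eventually, and the summands `E*(x; q) = primeAPError x q` are
nonnegative, so the level-`x^{θ−ε}` sum is dominated by the Wave0 sum. [cite: Vinogradov1965] -/
def bombieriVinogradovStatement : Prop :=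
  BombieriVinogradovStatement

/-- Bridge (outline §0): the prelude's `ElliottHalberstam` (`∀ θ < 1, PrimesHaveLevel θ`: BV shape
with `max_{y ≤ x}`, `ε`-slack in the level and `A > 0`) is equivalent to Wave0's parity.S25
`Literature.NumberTheory.Sieve.ElliottHalberstamConjecture` (`∀ θ < 1, EH θ`: no maximum over `y`, level exactly `x^θ`,
all real `A`). `→`: apply `PrimesHaveLevel (θ + ε)` with `θ + ε < 1` and bound the `y = x` term by
the supremum; `←`: the `ε`-slack is absorbed by `EH (θ − ε/2)`, and the maximum over `y ≤ x` is
recovered from `EH` at `≪ (log x)^{A+1}` points `y_j ∈ [x (log x)^{−A−1}, x]` by monotonicity of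
`ψ(·; q, a)` together with the trivial bound for small `y` (standard; Iwaniec–Kowalski §17.1). [cite: IwaniecKowalski2004, §17.1 (equivalent forms of the level of distribution of the primes)] -/
def elliottHalberstam_iff_wave0 : Prop :=
  LevelOfDistribution.ElliottHalberstam ↔ Literature.NumberTheory.Sieve.ElliottHalberstamConjecture

/-! ### parity.S26: the Type-I axioms of the shifted primes -/

/-- **parity.S26** (level of distribution of a sequence; Halberstam–Richert Ch. 1;
Friedlander–Iwaniec, *Opera de Cribro* Ch. 5; Ford–Maynard arXiv:2407.14368 §1; in-repo
`GbParityInterface.TypeI`). Packaging theorem for the definition-role id: the shifted primes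
`a_n = Λ(n + 2)` (size `X(x) = x`, density `g(d) = 1/φ(d)` for odd `d`, `0` for even `d`) have level of
distribution `x^θ` for every `θ < 1/2` in the sense of the prelude notion `HasLevelOfDistribution`
(Type-I remainder `∑_{d ≤ x^{θ−ε}} |A_d(x) − g(d) x| ≪ x (log x)^{−B}`), by Bombieri–Vinogradov
(`bombieriVinogradovStatement`) transported to the sequence layer
(`hasLevelOfDistribution_shiftedPrimes_of_primesHaveLevel`). The companion prelude notions of
parity.S26 are `HasTypeIIRange` (Type-II / bilinear information, Ford–Maynard),
`HasSieveDimension` (sieve dimension `κ`) and `IsWellFactorable` (BFI well-factorable weights). [cite: arXiv240714368] -/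
def shiftedPrimes_hasLevelOfDistribution : Prop :=
  ∀ θ : ℝ, θ < 1 / 2 → HasLevelOfDistribution (SieveSequence.shiftedPrimes 2) θ

/- interim proof relied on results that are now named facts (D-0014); demoted to a fact by the M5 import, proof preserved:
:=
  fun θ hθ =>
    hasLevelOfDistribution_shiftedPrimes_of_primesHaveLevel two_ne_zero
      (bombieriVinogradovStatement θ hθ)
-/

/-- **parity.S26** (sieve dimension; Halberstam–Richert Ch. 2, Lemma 2.4; Friedlander–Iwaniec
(5.38)). The shifted primes `Λ(n + 2)` have sieve dimension `1`: there is `K` with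
`∏_{w ≤ p < z} (1 − g(p))⁻¹ ≤ K log z / log w` (restating the prelude's
`hasSieveDimension_shiftedPrimes_one` at `h = 2`). [folklore] -/
def hasSieveDimension_shiftedPrimes_two_one : Prop :=
  ∃ K : ℝ, HasSieveDimension (SieveSequence.shiftedPrimes 2).density 1 K

/- interim proof relied on results that are now named facts (D-0014); demoted to a fact by the M5 import, proof preserved:
:=
  hasSieveDimension_shiftedPrimes_one even_two
-/

/-! ### parity.S32 (i): Selberg's examples `1 ± λ(n)` -/

/-- The density `g(d) = 1/d` of the integers (and of Selberg's sequences `1 ± λ(n)`), as a real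
arithmetic function (`g 0 = 0⁻¹ = 0`); this is Mathlib's `(ζ : ArithmeticFunction ℝ).pdiv ↑id`
written directly (Halberstam–Richert Ch. 1, Example 1). [folklore] -/
def reciprocalDensity : ArithmeticFunction ℝ :=
  ⟨fun d => (d : ℝ)⁻¹, by simp⟩

/-- Unfolding lemma for `reciprocalDensity` (definition). [folklore] -/
@[simp]
theorem reciprocalDensity_apply (d : ℕ) : reciprocalDensity d = (d : ℝ)⁻¹ := rfl

/-- `d ↦ 1/d` is multiplicative (indeed completely multiplicative). [folklore] -/
theorem isMultiplicative_reciprocalDensity : reciprocalDensity.IsMultiplicative :=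
  ⟨by simp, fun {m n} _ => by simp [mul_comm]⟩

/-- `|λ(n)| ≤ 1` for Mathlib's Liouville function (cast to `ℝ`; `λ(0) = 0`). [folklore] -/
theorem abs_liouville_le_one (n : ℕ) : |(ArithmeticFunction.liouville n : ℝ)| ≤ 1 := by
  rcases eq_or_ne n 0 with rfl | hn
  · simp
  · rw [ArithmeticFunction.liouville_apply hn]
    push_cast
    rw [abs_pow, abs_neg, abs_one, one_pow]

/-- **Selberg's parity sequences** (Selberg, Trondheim 1949 and Proc. Sympos. Pure Math. 20 (1971);
Friedlander–Iwaniec §16.1; Ford–Maynard 2024 §1): for a sign `sgn = ±1`,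
`a_n = 1 + sgn · λ(n) ∈ {0, 2}` (`λ` = Mathlib's `ArithmeticFunction.liouville`), with size `X(x) = x`
and density `g(d) = 1/d`. Since `∑_{n ≤ x, d ∣ n} λ(n) = λ(d) ∑_{m ≤ x/d} λ(m)` is tiny by the prime
number theorem, `𝒜_d(x) = x/d + (small)`: both sequences have exactly the Type-I data of the
integers, but `a_p = 0` for `sgn = 1` and `a_p = 2` for `sgn = −1`. [cite: Trondheim1949, and Proc. Sympos. Pure Math. 20 (1971] -/
def selbergParitySeq (sgn : ℤˣ) : SieveSequence where
  a n := ((1 + (sgn : ℤ) * ArithmeticFunction.liouville n : ℤ) : ℝ)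
  a_nonneg n := by
    have h1 := abs_liouville_le_one n
    rw [abs_le] at h1
    rcases Int.units_eq_one_or sgn with rfl | rfl <;> push_cast <;> linarith
  size x := x
  density := reciprocalDensity
  density_mult := isMultiplicative_reciprocalDensity

/-- Unfolding lemma for the terms of Selberg's sequences (definition). [folklore] -/
@[simp]
theorem selbergParitySeq_a (sgn : ℤˣ) (n : ℕ) :
    (selbergParitySeq sgn).a n = 1 + ((sgn : ℤ) : ℝ) * (ArithmeticFunction.liouville n : ℝ) := by
  simp [selbergParitySeq]

/-- Unfolding lemma: the size of Selberg's sequences is `X(x) = x` (definition). [folklore] -/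
@[simp]
theorem selbergParitySeq_size (sgn : ℤˣ) (x : ℝ) : (selbergParitySeq sgn).size x = x := rfl

/-- Unfolding lemma: the density of Selberg's sequences is `g(d) = 1/d` (definition). [folklore] -/
@[simp]
theorem selbergParitySeq_density (sgn : ℤˣ) : (selbergParitySeq sgn).density = reciprocalDensity :=
  rfl

/-- The terms of Selberg's sequences lie in `[0, 2]`. [folklore] -/
theorem selbergParitySeq_a_le_two (sgn : ℤˣ) (n : ℕ) : (selbergParitySeq sgn).a n ≤ 2 := by
  have h1 := abs_liouville_le_one n
  rw [abs_le] at h1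
  rcases Int.units_eq_one_or sgn with rfl | rfl <;> simp <;> linarith

/-- Selberg's sequences have level of distribution `x^θ` for every `θ < 1` (Selberg 1949; Ford–Maynard
2024 §1): `R_d(x) = (⌊x/d⌋ − x/d) ± λ(d) L(x/d)` with `L(y) = ∑_{m ≤ y} λ(m) ≪ y exp(−c √log y)`
(prime number theorem for `λ`), so `∑_{d ≤ x^{1−ε}} |R_d(x)| ≪_{ε,B} x (log x)^{−B}`. [cite: Selberg1949] -/
def selbergParitySeq_hasLevelOfDistribution : Prop :=
  ∀ (sgn : ℤˣ),
    ∀ θ : ℝ, θ < 1 → HasLevelOfDistribution (selbergParitySeq sgn) θ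

/-- The density `1/d` has sieve dimension `1`: `∏_{w ≤ p < z} (1 − 1/p)⁻¹ ≤ K log z / log w` for some
absolute `K` (Mertens' theorem; Halberstam–Richert Ch. 2, Lemma 2.4). [cite: HalberstamRichert1974, Ch. 2 Lemma 2.4 (Mertens)] -/
def hasSieveDimension_reciprocalDensity_one : Prop :=
  ∃ K : ℝ, HasSieveDimension reciprocalDensity 1 K

/-- Selberg's sequence `1 + λ(n)` vanishes at every prime: `λ(p) = −1` (zero prime mass). [folklore] -/
theorem selbergParitySeq_one_apply_prime {p : ℕ} (hp : p.Prime) : (selbergParitySeq 1).a p = 0 := by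
  simp [ArithmeticFunction.liouville_apply hp.ne_zero,
    ArithmeticFunction.cardFactors_apply_prime hp]

/-- Selberg's sequence `1 − λ(n)` equals `2` at every prime (double prime mass). [folklore] -/
theorem selbergParitySeq_neg_one_apply_prime {p : ℕ} (hp : p.Prime) :
    (selbergParitySeq (-1)).a p = 2 := by
  simp [ArithmeticFunction.liouville_apply hp.ne_zero,
    ArithmeticFunction.cardFactors_apply_prime hp]
  norm_num

/-- The prime mass of Selberg's sequence `1 − λ(n)` is twice the expected one:
`∑_{p ≤ x} (1 − λ(p)) = 2 π(x)`. [folklore] -/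
theorem selbergParitySeq_neg_one_sum_primes (x : ℕ) :
    ∑ p ∈ Nat.primesLE x, (selbergParitySeq (-1)).a p = 2 * Nat.primeCounting x := by
  rw [Finset.sum_congr rfl fun _ hp => selbergParitySeq_neg_one_apply_prime
    (Nat.mem_primesLE.mp hp).2, Finset.sum_const, nsmul_eq_mul, mul_comm,
    Nat.primesLE_card_eq_primeCounting]

/-- The prime mass of Selberg's sequence `1 + λ(n)` is zero: `∑_{p ≤ x} (1 + λ(p)) = 0`. [folklore] -/
theorem selbergParitySeq_one_sum_primes (x : ℕ) :
    ∑ p ∈ Nat.primesLE x, (selbergParitySeq 1).a p = 0 :=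
  Finset.sum_eq_zero fun _ hp => selbergParitySeq_one_apply_prime (Nat.mem_primesLE.mp hp).2

/-- **parity.S32** (i) (the parity barrier, Selberg's counterexample form; Selberg, Trondheim 1949 and
Proc. Sympos. Pure Math. 20 (1971); Ford–Maynard arXiv:2407.14368 §1; in-repo Lean statement
`GbParity.ClassABarrier` in `summits/gb/merged/sharpen-chen/lean/GbParityInterface.lean`). For every
`θ < 1` there is a sifted sequence with size `X(x) = x`, level of distribution `x^θ`, density of sieve
dimension `1`, and NO mass on the primes: the one-sequence Type-I axioms at any level `x^θ`, `θ < 1`,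
cannot detect primes. Witness: `selbergParitySeq 1` (`selbergParitySeq_hasLevelOfDistribution`,
`hasSieveDimension_reciprocalDensity_one`, `selbergParitySeq_one_apply_prime`). [cite: Trondheim1949, and Proc. Sympos. Pure Math. 20 (1971] -/
def parity_barrier_typeI : Prop :=
  ∀ (θ : ℝ) (hθ : θ < 1),
    ∃ A : SieveSequence, (∀ x, A.size x = x) ∧ HasLevelOfDistribution A θ ∧
      (∃ K : ℝ, HasSieveDimension A.density 1 K) ∧ ∀ p : ℕ, p.Prime → A.a p = 0

/- interim proof relied on results that are now named facts (D-0014); demoted to a fact by the M5 import, proof preserved: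
:=
  ⟨selbergParitySeq 1, fun _ => rfl, selbergParitySeq_hasLevelOfDistribution 1 θ hθ,
    hasSieveDimension_reciprocalDensity_one, fun _ hp => selbergParitySeq_one_apply_prime hp⟩
-/

/-- **parity.S32** (i), corollary (no Type-I lower bound for primes; Selberg 1949; Ford–Maynard 2024
§1). Fix `θ < 1`. For every sufficiently large dimension constant `K` (namely `K ≥ K₀`, where `K₀`
is a constant for which the density `1/d` satisfies `Ω(1)`; the guard removes the vacuous range of `K`
in which no sequence at all has dimension constant `K`) there is NO `c > 0` such that every sifted
sequence with `X(x) = x`, level `x^θ` and dimension `1` with constant `K` has prime mass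
`∑_{p ≤ x} a_p ≥ c x / log x` for all large `x`: Selberg's sequence `1 + λ(n)` has prime mass `0`. [cite: Selberg1949] -/
def no_typeI_prime_lower_bound : Prop :=
  ∀ (θ : ℝ) (hθ : θ < 1),
    ∃ K₀ : ℝ, ∀ K : ℝ, K₀ ≤ K → ¬ ∃ c : ℝ, 0 < c ∧ ∀ A : SieveSequence, (∀ x, A.size x = x) →
      HasLevelOfDistribution A θ → HasSieveDimension A.density 1 K →
        ∀ᶠ x : ℝ in atTop, c * x / Real.log x ≤ ∑ p ∈ Nat.primesLE ⌊x⌋₊, A.a p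

/- interim proof relied on results that are now named facts (D-0014); demoted to a fact by the M5 import, proof preserved:
:= by
  obtain ⟨K₀, hK₀⟩ := hasSieveDimension_reciprocalDensity_one
  refine ⟨K₀, fun K hK => ?_⟩
  rintro ⟨c, hc, h⟩
  have hev := h (selbergParitySeq 1) (fun _ => rfl) (selbergParitySeq_hasLevelOfDistribution 1 θ hθ)
    (hK₀.mono le_rfl hK)
  obtain ⟨x, hx, hx2⟩ := (hev.and (eventually_gt_atTop 1)).exists
  rw [selbergParitySeq_one_sum_primes] at hx
  exact absurd hx (not_le.mpr (div_pos (mul_pos hc (by linarith)) (Real.log_pos hx2)))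
-/

/-! ### parity.S32 (ii): Bombieri's asymptotic sieve -/

/-- The generalised von Mangoldt function `Λ_k = μ ⋆ log^k`, i.e.
`Λ_k(n) = ∑_{d ∣ n} μ(d) (log (n/d))^k` (Bombieri, *The asymptotic sieve* (1976), §1;
Friedlander–Iwaniec (3.1); Iwaniec–Kowalski (1.45)). Built from Mathlib's `μ` (coerced to `ℝ`),
`ArithmeticFunction.log` and the pointwise power `ppow`; `Λ_1 = Λ` (`generalizedVonMangoldt_one`) and
`Λ_0 = μ ⋆ ζ = 1` is the Dirichlet unit (Mathlib's convention `ppow f 0 = ζ`). `Λ_k` is supported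
on integers with at most `k` distinct prime factors. [folklore] -/
def generalizedVonMangoldt (k : ℕ) : ArithmeticFunction ℝ :=
  (μ : ArithmeticFunction ℝ) * ArithmeticFunction.log.ppow k

/-- `Λ_1 = Λ` (Mathlib's `moebius_mul_log_eq_vonMangoldt`). [folklore] -/
theorem generalizedVonMangoldt_one : generalizedVonMangoldt 1 = Λ := by
  rw [generalizedVonMangoldt, ArithmeticFunction.ppow_one,
    ArithmeticFunction.moebius_mul_log_eq_vonMangoldt]

/-- `Λ_k(n) = ∑_{d ∣ n} μ(d) (log (n/d))^k` for `k ≥ 1` (unfolding the Dirichlet convolution over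
`Nat.divisorsAntidiagonal`). [folklore] -/
theorem generalizedVonMangoldt_apply {k : ℕ} (hk : 0 < k) (n : ℕ) :
    generalizedVonMangoldt k n =
      ∑ x ∈ n.divisorsAntidiagonal, (μ x.1 : ℝ) * Real.log x.2 ^ k := by
  simp only [generalizedVonMangoldt, ArithmeticFunction.mul_apply, ArithmeticFunction.intCoe_apply,
    ArithmeticFunction.ppow_apply hk, ArithmeticFunction.log_apply]

namespace SieveSequence

/-- `A.HasDensityConstant H`: the singular-series constant of the density `g`,
`H = ∏_p (1 − g(p)) (1 − 1/p)⁻¹` (Bombieri 1976, (1.6); Friedlander–Iwaniec (3.21)), exists as the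
ordered limit of the partial products over `p ≤ x` (OUTLINE D-SIEVE-1: conditionally convergent Euler
products are ordered partial products + a `Tendsto` predicate) and equals `H`. For `g = 1/d`, `H = 1`;
for the shifted primes `Λ(n+2)`, `H = 2 C₂ = 𝔖({0,2})`. [cite: Bombieri1976, (1.6] -/
def HasDensityConstant (A : SieveSequence) (H : ℝ) : Prop :=
  Tendsto (fun x : ℕ => ∏ p ∈ Nat.primesLE x, (1 - A.density p) / (1 - (p : ℝ)⁻¹)) atTop (𝓝 H)

/-- `A.HasLinearDensity c`: the Mertens-type dimension-`1` asymptotic for the density,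
`∑_{p ≤ x} g(p) log p = log x + c + O_B((log x)^{−B})` for every `B > 0` (Bombieri 1976, (1.4)–(1.5);
Friedlander–Iwaniec (3.20), in the strong form with arbitrary logarithmic saving, which holds for
`g = 1/d` and `g = 1/φ(d)·1_{d odd}` by the prime number theorem). [cite: Bombieri1976, (1.4] -/
def HasLinearDensity (A : SieveSequence) (c : ℝ) : Prop :=
  ∀ B : ℝ, 0 < B →
    (fun x : ℝ => (∑ p ∈ Nat.primesLE ⌊x⌋₊, A.density p * Real.log p) - (Real.log x + c))
      =O[atTop] fun x : ℝ => (Real.log x ^ B)⁻¹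

end SieveSequence

/-- The integers' density `1/d` has singular-series constant `H = 1` (every factor of the defining
product equals `1`). [folklore] -/
theorem hasDensityConstant_selbergParitySeq (sgn : ℤˣ) :
    (selbergParitySeq sgn).HasDensityConstant 1 := by
  refine tendsto_const_nhds.congr fun x => ?_
  refine (Finset.prod_eq_one fun p hp => ?_).symm
  have hp1 : (1 : ℝ) < p := by exact_mod_cast (Nat.mem_primesLE.mp hp).2.one_lt
  rw [selbergParitySeq_density, reciprocalDensity_apply, div_self]
  exact sub_ne_zero.mpr (ne_of_gt (inv_lt_one_of_one_lt₀ hp1))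

/-- **parity.S32** (ii) (**Bombieri's asymptotic sieve**; Bombieri, *The asymptotic sieve*, Rend.
Accad. Naz. XL (5) 1/2 (1975/76), Theorem; Friedlander–Iwaniec, *Opera de Cribro*, Thm 3.5). Let
`k ≥ 2` and let `𝒜 = (a_n)` be a sifted sequence with `X(x) = x`, multiplicative density `g` of sieve
dimension `1` with `∑_{p ≤ x} g(p) log p = log x + c + O((log x)^{−B})`, singular-series constant
`H = ∏_p (1 − g(p))(1 − 1/p)⁻¹`, level of distribution `x^θ` for EVERY `θ < 1`, and the crude bound
`∑_{n ≤ x} a_n² ≪ x (log x)^C`. Then `∑_{n ≤ x} Λ_k(n) a_n ∼ k H x (log x)^{k−1}`.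
Transcription note: the hypotheses `HasLinearDensity` (arbitrary log saving), `HasSieveDimension`
and the second-moment bound are mild strengthenings of Bombieri's (1.3)–(1.7), all satisfied by
`1 ± λ(n)` and by `Λ(n+2)`; the conclusion is his. For `k = 1` the statement is FALSE
(`bombieri_asymptotic_sieve_indeterminacy`). [cite: BombieriAsymptoticSieve1976, main theorem] [cite: FriedlanderIwaniecOpera2010, Ch. 3 (Bombieri's sieve)] -/
def bombieri_asymptotic_sieve : Prop :=
  ∀ (k : ℕ) (hk : 2 ≤ k) (A : SieveSequence) (H c : ℝ) (hsize : ∀ x, A.size x = x) (hdim : ∃ K : ℝ, HasSieveDimension A.density 1 K) (hlin : A.HasLinearDensity c) (hH : A.HasDensityConstant H) (hlevel : ∀ θ : ℝ, θ < 1 → HasLevelOfDistribution A θ) (hcrude : ∃ C : ℝ, (fun x : ℝ => ∑ n ∈ Ioc 0 ⌊x⌋₊, A.a n ^ 2) =O[atTop] fun x : ℝ => x * Real.log x ^ C),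
    (fun x : ℝ => ∑ n ∈ Ioc 0 ⌊x⌋₊, generalizedVonMangoldt k n * A.a n) ~[atTop]
      fun x : ℝ => k * H * x * Real.log x ^ (k - 1)

/-- **parity.S32** (ii), application (Bombieri 1976, §1; Friedlander–Iwaniec §3.5): under the
Elliott–Halberstam conjecture the shifted primes `Λ(n + 2)` have level `x^θ` for every `θ < 1`
(`hasLevelOfDistribution_shiftedPrimes_of_primesHaveLevel`), so Bombieri's asymptotic sieve gives,
for every `k ≥ 2`, `∑_{n ≤ x} Λ_k(n) Λ(n + 2) ∼ k H x (log x)^{k−1}` with `H = 𝔖({0,2}) = 2 C₂` the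
singular-series constant of the density `1/φ(d)·1_{d odd}` (here any `H` with
`(shiftedPrimes 2).HasDensityConstant H`; the limit exists by Mertens). Thus EH determines the
correlations of `Λ(n+2)` with `Λ_k`, `k ≥ 2` — but not with `Λ = Λ_1` (twin primes). [cite: Bombieri1976, §1] -/
def bombieri_asymptotic_sieve_shiftedPrimes : Prop :=
  ∀ (hEH : LevelOfDistribution.ElliottHalberstam) (k : ℕ) (hk : 2 ≤ k) (H : ℝ) (hH : (SieveSequence.shiftedPrimes 2).HasDensityConstant H),
    (fun x : ℝ => ∑ n ∈ Ioc 0 ⌊x⌋₊, generalizedVonMangoldt k n * Λ (n + 2)) ~[atTop]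
      fun x : ℝ => k * H * x * Real.log x ^ (k - 1)

/-- **parity.S32** (ii) (upper half of Bombieri's indeterminacy range; Bombieri 1976, §1; Selberg's
upper-bound sieve, Friedlander–Iwaniec Thm 7.1 / §3.5). Under the hypotheses of the asymptotic sieve
the prime mass satisfies only the ONE-sided bound `∑_{n ≤ x} Λ(n) a_n ≤ (2 + ε) H x` for large `x`:
the case `k = 1` of the asymptotic sieve holds up to a factor `δ_x ∈ [0, 2]`. [cite: Bombieri1976, §1] -/
def prime_mass_le_two : Prop :=
  ∀ (A : SieveSequence) (H c : ℝ) (hsize : ∀ x, A.size x = x) (hdim : ∃ K : ℝ, HasSieveDimension A.density 1 K) (hlin : A.HasLinearDensity c) (hH : A.HasDensityConstant H) (hlevel : ∀ θ : ℝ, θ < 1 → HasLevelOfDistribution A θ) (hcrude : ∃ C : ℝ, (fun x : ℝ => ∑ n ∈ Ioc 0 ⌊x⌋₊, A.a n ^ 2) =O[atTop] fun x : ℝ => x * Real.log x ^ C) (ε : ℝ) (hε : 0 < ε),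
    ∀ᶠ x : ℝ in atTop, ∑ n ∈ Ioc 0 ⌊x⌋₊, Λ n * A.a n ≤ (2 + ε) * H * x

/-- **parity.S32** (ii) (**indeterminacy of the asymptotic sieve for `k = 1`**; Bombieri, *The
asymptotic sieve* (1976), §1 and Thm 2 (sharpness via Selberg's examples); Selberg 1949;
Friedlander–Iwaniec §3.5 and §16.1). Every `δ ∈ [0, 2]` is realised: there is a sifted sequence with
EXACTLY the Type-I data of the integers — `X(x) = x`, density `1/d` (so `H = 1`, dimension `1`),
level of distribution `x^θ` for every `θ < 1`, terms in `[0, 2]` — whose prime mass is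
`∑_{p ≤ x} a_p = δ π(x)` for all `x` (witness `a_n = 1 + (1 − δ) λ(n)`, using `λ(p) = −1`; the
endpoints `δ = 0, 2` are `selbergParitySeq 1`, `selbergParitySeq (−1)`). Hence one-sequence Type-I axioms of any level `< 1` determine
`∑_{p ≤ x} a_p ∼ δ H x / log x` only up to the scalar `δ ∈ [0, 2]`. [cite: Selberg1949] -/
def bombieri_asymptotic_sieve_indeterminacy : Prop :=
  ∀ (δ : ℝ) (hδ : δ ∈ Set.Icc (0 : ℝ) 2),
    ∃ A : SieveSequence, (∀ x, A.size x = x) ∧ A.density = reciprocalDensity ∧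
      (∀ θ : ℝ, θ < 1 → HasLevelOfDistribution A θ) ∧ (∀ n, A.a n ≤ 2) ∧
        ∀ x : ℕ, ∑ p ∈ Nat.primesLE x, A.a p = δ * Nat.primeCounting x

end Literature.NumberTheory.Sieve
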